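import Summits.Ventures.PercRepro.ProfileGapMonoThresholdSucc

/-!
# PercRepro — THE OFFSET-0 DELETION STATEMENT IS p10's GAP-MONOTONICITY OF THE ROW (p5, gen 24;
`proofs/P5-GM1.md` §23(a); announced INBOX 12040)

`DelMonoT N z q (q−1)` is, term for term, `GapMonoQ N z (q−1) q` (the weights `C(ρ(E∖B), 1) = ρ(E∖B)` and
`C(q, q−1) = q`, exactly as in `thresholdIneq_iff_row`); with `delMonoT_pred_iff`, so is `DelMonoT N z q q`.
Hence p10's all-points statement `GapMonoAllQ α (q−1) q` gives the rule on the hard class at the offsets `−1` and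
`0`, and `HardRuleT α q q` is p10's gap-monotonicity rule for the row `(q−1, q)` restricted to the hard class.

* **`delMonoT_pred_iff_gapMonoQ`**, **`delMonoT_self_iff_gapMonoQ`**, `hardRuleT_pred_of_gapMonoAllQ`,
  **`hardRuleT_self_of_gapMonoAllQ`**, **`thresholdIneq_succ_of_gapMonoAllQ`**.
-/

open scoped Matroid

namespace PercRepro.Cogirth

open Finset ThmH Skew Shadow Profile

variable {α : Type} [DecidableEq α] {M : Matroid α} [M.Finite]

section RowLink

variable {N : Matroid α} [N.Finite] {z : α} {q : ℕ}

/-- **`DelMonoT` at the offset `−1` is `GapMonoQ` of the row `(q−1, q)`** (`1 ≤ q`). -/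
theorem delMonoT_pred_iff_gapMonoQ (hq : 1 ≤ q) : DelMonoT N z q (q - 1) ↔ GapMonoQ N z (q - 1) q := by
  unfold DelMonoT thresholdSum GapMonoQ demand
  have h1 : q - 1 + 1 = q := by omega
  have h2 : q - (q - 1) = 1 := by omega
  simp only [h1, h2, choose_pred_self hq, Nat.choose_one_right]

/-- **`DelMonoT` at the offset `0` is `GapMonoQ` of the row `(q−1, q)`** (`1 ≤ q`). -/
theorem delMonoT_self_iff_gapMonoQ (hq : 1 ≤ q) : DelMonoT N z q q ↔ GapMonoQ N z (q - 1) q :=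
  (delMonoT_pred_iff hq).symm.trans (delMonoT_pred_iff_gapMonoQ hq)

/-- p10's all-points statement for the row `(q−1, q)` gives the rule on the hard class at the offset `−1`. -/
theorem hardRuleT_pred_of_gapMonoAllQ (hq : 1 ≤ q) (h : GapMonoAllQ α (q - 1) q) : HardRuleT α q (q - 1) := by
  intro K _ _ hne
  obtain ⟨z, hz⟩ := hne
  exact ⟨z, hz, (delMonoT_pred_iff_gapMonoQ hq).2 (h K z hz)⟩

/-- **p10's all-points statement for the row `(q−1, q)` gives the rule on the hard class at the offset `0`.** -/
theorem hardRuleT_self_of_gapMonoAllQ (hq : 1 ≤ q) (h : GapMonoAllQ α (q - 1) q) : HardRuleT α q q :=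
  (hardRuleT_pred_iff hq).1 (hardRuleT_pred_of_gapMonoAllQ hq h)

/-- **The band case `(I_{q+1})` from the single rule instance `(q, q+1)`, the family one co-rank down, and the row
as a theorem** (`2 ≤ q`). -/
theorem thresholdIneq_succ_of_gapMonoAllQ {q : ℕ} (hq : 2 ≤ q)
    (hprev : ∀ (K : Matroid α) [K.Finite] (t' : ℕ), q - 1 ≤ t' → ThresholdIneq K (q - 1) t')
    (hrow : ∀ (K : Matroid α) [K.Finite], ProfileIneqMinusQ K (q - 1) q)
    (hrule : HardRuleT α q (q + 1)) (N : Matroid α) [N.Finite] : ThresholdIneq N q (q + 1) :=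
  thresholdIneq_succ_of_hardRuleT hq hprev
    (fun K _ => (thresholdIneq_pred_iff (by omega)).1 ((thresholdIneq_iff_row (by omega)).2 (hrow K))) hrule N

end RowLink

end PercRepro.Cogirth
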